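import Summits.CriticalPhenomena.PercolationContinuityZ3.Theorems.PercNearOneGluingNoHeavyLowerTailThreePointHalvingCross
import Summits.CriticalPhenomena.PercolationContinuityZ3.Theorems.PercNearOneGluingAdditiveGluingOneBond
import Literature.Probability.Percolation.KozmaNitzanSeparatingTriple
import HarnessLib

/-!
# The cross inequality (XI) at an `a`–`v` pair from the SHARP halving lemma on the two pencil minors
# (Sahi programme, prover prim-sahi-p2 gen 50)

Support file (`--supports stmt-CriticalPhenomena-4575`, helper), continuing `…ThreePointHalvingCross` (gen 45: pencil identity and the
schema `HalvingCross.halvingUD_of_cross`) and `…CrossTerminalPair` / `…CrossNonterminal` (gen 46).  No definitions, no named facts,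
no sorries; standard axioms.  Memo `run/shared/lean/prim/prim-sahi/FROM-prim-sahi-p2-gen50-PENCIL-LP.md`, `prim-sahi-p2/PROOF-E3.md` §60.

SETTING.  Terminals `s a c`, a fourth vertex `v`, the pair `e = s(a,v)`, `μ = P_{w[e↦0]}`, `ν = P_{w[e↦1]}`, `U = {s↔a} ∪ {c↔a}`,
`D = {s↮c}`, `X = U ∩ D`.  Gen 50's pencil-LP programme (PROOF-E3 §60) showed that the cross inequality
(XI) `μ(U)ν(D) + ν(U)μ(D) ≤ 2μ(X) + 2ν(X)` — the one missing input of the edge-induction schema for the halving lemma (v) `P(U)P(D) ≤ 2P(X)` —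
is NOT implied by (v) on the two minors together with every known law-level row, but IS implied, with an explicit two-row certificate, by the
SHARP halving inequality `2·P(U)P(D) ≤ 3·P(X)` on the two minors (the 'gap-½ phenomenon').  This file is the kernel version of that certificate.
* (inside the proof) `ν(S) = μ((insert e)⁻¹' S)` — the landed push-forward `goodStepEI_prodBernoulli_map_insert` (= `tieLiftOne_real_one_eq`,
  not re-declared here).
* `preimage_insert_U`, `preimage_insert_D` — the events seen through the opened pair: `(insert e)⁻¹' U = U ∪ {s↔v} ∪ {c↔v}`,
  `(insert e)⁻¹' D = D ∖ K` with the 'cross-link' event `K = ({s↔a} ∩ {c↔v}) ∪ ({s↔v} ∩ {c↔a})` (`KNSep.reachable_insert_iff`). [this work]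
* `cross_of_sharp_reals` — the arithmetic: with `u₁ = u₀ + ρ`, `d₁ = d₀ − κ`, `x₁ = x₀ − κ + ρ'`, `0 ≤ κ ≤ x₀`, `κ ≤ d₀`, `u₀ + ρ ≤ 1`,
  the sharp inequalities `u₀d₀ ≤ 3/2·x₀`, `u₁d₁ ≤ 3/2·x₁` give `u₀d₁ + u₁d₀ ≤ 2x₀ + 2x₁`; indeed
  `S − ⅔F_{3/2}(μ) − (4/3)F_{3/2}(ν) = x₀ − ⅓u₀κ + ⅓ρd₀ − (4/3)ρκ ≥ x₀ − κ ≥ 0`. [this work]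
* **`cross_of_sharp_minors_av`** [this work] — THE LEMMA: if `2μ(U)μ(D) ≤ 3μ(X)` and `2ν(U)ν(D) ≤ 3ν(X)` then (XI) holds at `e = s(a,v)`
  for every vertex `v`, every finite vertex type `Fin n` and every weight function (no distinctness hypotheses are needed).
Nothing here asserts the sharp halving inequality; numerically `sup P(U)P(D)/P(X) = 1.19694…` (hub products, PROOF-E3 §60e) `< 3/2`.
-/

noncomputable section

namespace Summit.CriticalPhenomena.PercolationContinuityZ3.Theorems

namespace HalvingCross

open MeasureTheory Set Literature.Probability.Percolation Literature.Probability.LatticeModels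
open scoped Classical

variable {n : ℕ}

section events
variable {s a c v : Fin n}

/-- Through the opened pair `av`, `a` reaches `{s,c}` iff `a` or `v` does (without the pair). [this work] -/
theorem preimage_insert_U :
    (fun ω : BondConfig (Fin n) => insert s(a, v) ω) ⁻¹' (openConn s a ∪ openConn c a) =
      (openConn s a ∪ openConn c a) ∪ (openConn s v ∪ openConn c v) := by
  ext ω
  rw [mem_preimage]
  change ((openGraph (insert s(a, v) ω)).Reachable s a ∨ (openGraph (insert s(a, v) ω)).Reachable c a) ↔
    (((openGraph ω).Reachable s a ∨ (openGraph ω).Reachable c a) ∨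
      ((openGraph ω).Reachable s v ∨ (openGraph ω).Reachable c v))
  rw [KNSep.reachable_insert_iff, KNSep.reachable_insert_iff]
  constructor
  · rintro (h | h)
    · rcases h with h | ⟨h, -⟩ | ⟨h, -⟩
      · exact Or.inl (Or.inl h)
      · exact Or.inl (Or.inl h)
      · exact Or.inr (Or.inl h)
    · rcases h with h | ⟨h, -⟩ | ⟨h, -⟩
      · exact Or.inl (Or.inr h)
      · exact Or.inl (Or.inr h)
      · exact Or.inr (Or.inr h)
  · rintro ((h | h) | (h | h))
    · exact Or.inl (Or.inl h)
    · exact Or.inr (Or.inl h)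
    · exact Or.inl (Or.inr (Or.inr ⟨h, SimpleGraph.Reachable.refl _⟩))
    · exact Or.inr (Or.inr (Or.inr ⟨h, SimpleGraph.Reachable.refl _⟩))

/-- Through the opened pair `av`, `s ↮ c` iff `s ↮ c` without the pair and the pair does not cross-link them:
`(insert av)⁻¹' {s↮c} = {s↮c} ∖ K`, `K = ({s↔a} ∩ {c↔v}) ∪ ({s↔v} ∩ {c↔a})`. [this work] -/
theorem preimage_insert_D :
    (fun ω : BondConfig (Fin n) => insert s(a, v) ω) ⁻¹' ((openConn s c)ᶜ : Set (BondConfig (Fin n))) =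
      (openConn s c)ᶜ \ ((openConn s a ∩ openConn c v) ∪ (openConn s v ∩ openConn c a)) := by
  ext ω
  rw [mem_preimage, mem_sdiff, mem_compl_iff, mem_compl_iff]
  change ¬ (openGraph (insert s(a, v) ω)).Reachable s c ↔
    ¬ (openGraph ω).Reachable s c ∧
      ω ∉ ((openConn s a ∩ openConn c v) ∪ (openConn s v ∩ openConn c a) : Set (BondConfig (Fin n)))
  rw [KNSep.reachable_insert_iff]
  simp only [mem_union, mem_inter_iff, openConn, mem_setOf_eq, not_or]
  constructor
  · rintro ⟨h1, h2, h3⟩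
    exact ⟨h1, fun h => h2 ⟨h.1, h.2.symm⟩, fun h => h3 ⟨h.1, h.2.symm⟩⟩
  · rintro ⟨h1, h2, h3⟩
    exact ⟨h1, fun h => h2 ⟨h.1, h.2.symm⟩, fun h => h3 ⟨h.1, h.2.symm⟩⟩

end events

/-- **The arithmetic of the two-row certificate.**  [this work] -/
theorem cross_of_sharp_reals {x0 u0 d0 ρ ρ' κ : ℝ} (hκ0 : 0 ≤ κ) (hκx : κ ≤ x0) (hκd : κ ≤ d0) (hu0 : 0 ≤ u0) (hρ : 0 ≤ ρ)
    (huρ : u0 + ρ ≤ 1) (h0 : u0 * d0 ≤ 3 / 2 * x0) (h1 : (u0 + ρ) * (d0 - κ) ≤ 3 / 2 * (x0 - κ + ρ')) :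
    u0 * (d0 - κ) + (u0 + ρ) * d0 ≤ 2 * x0 + 2 * (x0 - κ + ρ') := by
  have key : 1 / 3 * (u0 * κ) - 1 / 3 * (ρ * d0) + 4 / 3 * (ρ * κ) ≤ x0 := by
    nlinarith [mul_nonneg hρ (sub_nonneg.2 hκd), mul_nonneg hu0 hκ0, mul_nonneg hρ hκ0,
      mul_le_mul_of_nonneg_right huρ hκ0]
  nlinarith [key, h0, h1]

/-- **THE CROSS INEQUALITY AT AN `a`–`v` PAIR FROM THE SHARP HALVING ON THE TWO MINORS.**  `e = s(a,v)`, `μ = P_{w[e↦0]}`,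
`ν = P_{w[e↦1]}`, `U = {s↔a} ∪ {c↔a}`, `D = {s↮c}`, `X = U ∩ D`: if `μ(U)μ(D) ≤ 3/2·μ(X)` and `ν(U)ν(D) ≤ 3/2·ν(X)` then
`μ(U)ν(D) + ν(U)μ(D) ≤ 2μ(X) + 2ν(X)`. [this work] -/
theorem cross_of_sharp_minors_av (w : Sym2 (Fin n) → unitInterval) (s a c v : Fin n)
    (h0 : (prodBernoulli (Function.update w s(a, v) 0)).real (openConn s a ∪ openConn c a) *
        (prodBernoulli (Function.update w s(a, v) 0)).real ((openConn s c)ᶜ) ≤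
      3 / 2 * (prodBernoulli (Function.update w s(a, v) 0)).real ((openConn s a ∪ openConn c a) ∩ (openConn s c)ᶜ))
    (h1 : (prodBernoulli (Function.update w s(a, v) 1)).real (openConn s a ∪ openConn c a) *
        (prodBernoulli (Function.update w s(a, v) 1)).real ((openConn s c)ᶜ) ≤
      3 / 2 * (prodBernoulli (Function.update w s(a, v) 1)).real ((openConn s a ∪ openConn c a) ∩ (openConn s c)ᶜ)) :
    (prodBernoulli (Function.update w s(a, v) 0)).real (openConn s a ∪ openConn c a) *
          (prodBernoulli (Function.update w s(a, v) 1)).real ((openConn s c)ᶜ) +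
        (prodBernoulli (Function.update w s(a, v) 1)).real (openConn s a ∪ openConn c a) *
          (prodBernoulli (Function.update w s(a, v) 0)).real ((openConn s c)ᶜ) ≤
      2 * (prodBernoulli (Function.update w s(a, v) 0)).real ((openConn s a ∪ openConn c a) ∩ (openConn s c)ᶜ) +
        2 * (prodBernoulli (Function.update w s(a, v) 1)).real ((openConn s a ∪ openConn c a) ∩ (openConn s c)ᶜ) := by
  set μ := prodBernoulli (Function.update w s(a, v) 0) with hμ
  set Uev : Set (BondConfig (Fin n)) := openConn s a ∪ openConn c a with hUev
  set Dev : Set (BondConfig (Fin n)) := (openConn s c)ᶜ with hDev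
  set Rev : Set (BondConfig (Fin n)) := openConn s v ∪ openConn c v with hRev
  set Kev : Set (BondConfig (Fin n)) := (openConn s a ∩ openConn c v) ∪ (openConn s v ∩ openConn c a) with hKev
  -- ν-probabilities as μ-probabilities of preimages (push-forward under `insert e`)
  have hre : ∀ S : Set (BondConfig (Fin n)), (prodBernoulli (Function.update w s(a, v) 1)).real S =
      μ.real ((fun ω : BondConfig (Fin n) => insert s(a, v) ω) ⁻¹' S) := fun S => by
    rw [hμ, ← map_measureReal_apply (Measurable.of_discrete) MeasurableSet.of_discrete,
      goodStepEI_prodBernoulli_map_insert, Function.update_idem]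
  have nU : (prodBernoulli (Function.update w s(a, v) 1)).real Uev = μ.real (Uev ∪ Rev) := by
    rw [hre, hUev, preimage_insert_U]
  have nD : (prodBernoulli (Function.update w s(a, v) 1)).real Dev = μ.real (Dev \ Kev) := by
    rw [hre, hDev, preimage_insert_D]
  have nX : (prodBernoulli (Function.update w s(a, v) 1)).real (Uev ∩ Dev) = μ.real ((Uev ∪ Rev) ∩ (Dev \ Kev)) := by
    rw [hre, Set.preimage_inter, hUev, hDev, preimage_insert_U, preimage_insert_D]
  -- the cells
  set u0 : ℝ := μ.real Uev with hu0
  set d0 : ℝ := μ.real Dev with hd0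
  set x0 : ℝ := μ.real (Uev ∩ Dev) with hx0
  set ρ : ℝ := μ.real (Rev \ Uev) with hρ
  set κ : ℝ := μ.real (Dev ∩ Kev) with hκ
  set ρ' : ℝ := μ.real ((Rev \ Uev) ∩ (Dev \ Kev)) with hρ'
  -- `K ∩ D ⊆ U`: a cross-link uses `a ↔ s` or `a ↔ c`
  have hKU : Dev ∩ Kev ⊆ Uev ∩ Dev := by
    intro ω hω
    refine ⟨?_, hω.1⟩
    rcases hω.2 with ⟨h, -⟩ | ⟨-, h⟩
    · exact Or.inl h
    · exact Or.inr h
  have eU1 : μ.real (Uev ∪ Rev) = u0 + ρ := by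
    rw [← Set.union_sdiff_self, measureReal_union Set.disjoint_sdiff_right MeasurableSet.of_discrete]
  have eD1 : μ.real (Dev \ Kev) = d0 - κ := by
    have h := measureReal_inter_add_sdiff (μ := μ) (s := Dev) (t := Kev) MeasurableSet.of_discrete
    linarith
  have eX1 : μ.real ((Uev ∪ Rev) ∩ (Dev \ Kev)) = x0 - κ + ρ' := by
    have hsplit : (Uev ∪ Rev) ∩ (Dev \ Kev) = (Uev ∩ (Dev \ Kev)) ∪ ((Rev \ Uev) ∩ (Dev \ Kev)) := by
      ext ω; simp only [mem_inter_iff, mem_union, mem_sdiff]; tauto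
    have hdisj : Disjoint (Uev ∩ (Dev \ Kev)) ((Rev \ Uev) ∩ (Dev \ Kev)) :=
      Set.disjoint_left.2 fun ω h1 h2 => h2.1.2 h1.1
    rw [hsplit, measureReal_union hdisj MeasurableSet.of_discrete]
    have h := measureReal_inter_add_sdiff (μ := μ) (s := Uev ∩ Dev) (t := Kev) MeasurableSet.of_discrete
    have e1 : (Uev ∩ Dev) ∩ Kev = Dev ∩ Kev := by
      ext ω; constructor
      · rintro ⟨⟨-, hD⟩, hK⟩; exact ⟨hD, hK⟩
      · intro hω; exact ⟨hKU hω, hω.2⟩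
    have e2 : (Uev ∩ Dev) \ Kev = Uev ∩ (Dev \ Kev) := by
      ext ω; simp only [mem_inter_iff, mem_sdiff]; tauto
    rw [e1, e2] at h
    linarith
  -- constraints
  have hκx : κ ≤ x0 := measureReal_mono hKU
  have hκd : κ ≤ d0 := measureReal_mono Set.inter_subset_left
  have hκ0 : 0 ≤ κ := measureReal_nonneg
  have hu00 : 0 ≤ u0 := measureReal_nonneg
  have hρ0 : 0 ≤ ρ := measureReal_nonneg
  have huρ : u0 + ρ ≤ 1 := by rw [← eU1]; exact measureReal_le_one
  -- rewrite everything in the cells and conclude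
  rw [nU, nD, nX, eU1, eD1, eX1] at h1 ⊢
  exact cross_of_sharp_reals hκ0 hκx hκd hu00 hρ0 huρ h0 h1

end HalvingCross

end Summit.CriticalPhenomena.PercolationContinuityZ3.Theorems

end
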